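import Literature.NumberTheory.Automorphic.UnitaryBorelModulusIndex
import Literature.NumberTheory.Automorphic.UnitaryRankOneBasicHeckeOperator
import HarnessLib

/-!
# The classical `w₀`-symmetry of the Satake transforms of the unramified unitary groups `U(σ, J₀)`, FOR EVERY `N`:
# `𝒮(T)_{-μ} = 𝒮(T)_μ` for the unitarily normalised transform `𝒮 = δ^{1/2}·𝒮_1` of every Hecke operator
# (Cartier Thm. 4.1 for `w₀ = -1`; Laumon (4.1.4)–(4.1.6); Mínguez §4; Rogawski §4.5)

Topic `NumberTheory/Automorphic`; namespace `Literature.NumberTheory.Automorphic.HermitianLattice[.UnramifiedLocalConjDatum]`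
(lane `lit-hodgefound`, Track 2 foundations; seat `lit-hodgefound-p11`, generation 47, row g47-#3).  THEOREMS ONLY: no
definition, no named fact, no instance, no notation.  Sequel of `HyperspecialUnitarySatakeDuality` (g44-#3: the weighted
duality `𝒮_w(T)_μ · w(-μ) · [t_μK_Pt_μ⁻¹ : K_P ∩ t_μK_Pt_μ⁻¹] = 𝒮_w(T)_{-μ} · w(μ) · [K_P : K_P ∩ t_μK_Pt_μ⁻¹]` for every `N`),
`UnitaryBorelModulusIndex` (g47-#2: the index `[K_P : K_P ∩ t_μK_Pt_μ⁻¹]` EVALUATED for every `N`) and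
`UnitaryRankOneSatakeClassical` (g46-#3: the conclusion `𝒮(T)_{-μ} = 𝒮(T)_μ` for `N = 2, 3` only).  Here the conclusion is
drawn for every `N`.

## The mathematics

`hd : UnramifiedLocalConjDatum σ ϖ`, `σ ≠ id`, `q = #𝓀[K]` finite (a square, `√q = q_F`), `G = U(σ, J₀) ≤ GL_N(K)`, `K₀`
hyperspecial, `K_P = N(𝒪)`, `t_μ = diag(ϖ^μ)` for antisymmetric `μ` (`μ_{i'} = -μ_i`, `i' = N - 1 - i`), and the tree's
unitarily normalised Satake transform `𝒮 = hd.satakeTransform` (weights `(√q)^{-⟨ν, a⟩}`, `⟨ν, a⟩ = ∑_i (N-1-i) a_i`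
= `satakeTwistExp a`, `HyperspecialUnitarySatakeTransform`).

* (§1) The double count `∑_{i<j} (a_i - a_j) = ∑_i (N - 1 - 2i) a_i` (`= 2⟨ν, a⟩` for antisymmetric `a`,
  `two_mul_satakeTwistExp_of_rev`).
* (§2) The DUAL index: conjugating by `t_μ⁻¹ = t_{-μ}`, g47-#2 gives
  `[t_μK_Pt_μ⁻¹ : K_P ∩ t_μK_Pt_μ⁻¹] = q^{∑_{i<j, i<j'} (μ_j-μ_i)⁺} · (√q)^{∑_{i<i'} (μ_{i'}-μ_i)⁺}`, and for `c` ANTIDOMINANT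
  (monotone) the closed form `(√q)^{∑_{i<j}(c_j - c_i)}`; hence the number of left `K₀`-cosets of `K₀t_cK₀` at the dominant
  extreme (g44-#3 `card_filter_iwasawaExp_orbit_neg_eq_relIndex_unitary`) is **`#{γ ∈ K₀t_cK₀/K₀ : a(γ) = -c} = (√q)^{∑_{i<j}(c_j-c_i)}`**
  `= q_F^{⟨2ρ, -c⟩}` for every `N` — the cardinality of the big cell (Macdonald V (2.6)–(2.7); Laumon (4.1.6)).
* (§3) Exponent bookkeeping: with `E(μ) = [K_P : K_P ∩ t_μK_Pt_μ⁻¹] = (√q)^{e(μ)}`, `e(μ) = 2∑_{i<j,i<j'}(μ_i-μ_j)⁺ + ∑_{i<i'}(μ_i-μ_{i'})⁺`,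
  one has `e(μ) - e(-μ) = ∑_{i<j}(μ_i - μ_j) = 2⟨ν, μ⟩` (`x⁺ - (-x)⁺ = x` termwise, g47-#2 `two_mul_sum_add_sum_eq`, §1).
* (§4) Therefore, in g44-#3's weighted duality with `w(μ) = (√q)^{-⟨ν, μ⟩}` both sides equal `𝒮(T)_{±μ} · (√q)^{m}` with the
  same exponent `m = ⟨ν, μ⟩ + e(-μ) = -⟨ν, μ⟩ + e(μ)`, and **`𝒮(T)_{-μ} = 𝒮(T)_μ` for every `N`, every `T ∈ ℋ(U(σ, J₀), K₀; ℂ)`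
  and every `μ`** (`coeff_satakeTransform_neg_unitary`; off `Λ⁻ = {μ : μ ∘ rev = -μ}` both vanish): the Satake image lies
  in the `w₀ = -1` invariants, `ι(𝒮 T) = 𝒮 T` (`domCongr_neg_satakeTransform_unitary`).  For `N = 2, 3`, where `W = {1, w₀}`,
  this is the whole `W`-invariance (g46-#3 concluded `range 𝒮 = ℂ[Λ⁻]^W` there); for `N ≥ 4` the `S_n`-part of `W` is not
  addressed here.

## What is formalised (theorems only)

* §1 `sum_filter_lt_fst_eq`, `sum_filter_lt_snd_eq`, **`sum_filter_lt_sub_eq`** (`∑_{i<j}(a_i - a_j) = ∑_i (N-1-2i) a_i`),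
  `sum_filter_lt_sub_eq_two_mul_satakeTwistExp`, `satakeTwistExp_neg`.
* §2 `relIndex_borelInt_conjAct_eq_unitary` (the dual index for every antisymmetric `μ`),
  `relIndex_borelInt_conjAct_eq_pow_sum_unitary` (antidominant closed form),
  **`card_filter_iwasawaExp_orbit_neg_eq_pow_unitary`** (the dominant-extreme coset count, every `N`).
* §3 `toNat_sum_sub_toNat_sum_neg`, `modulusExp_sub_modulusExp_neg` (`e(μ) - e(-μ) = 2⟨ν, μ⟩`),
  `natCast_relIndex_conjAct_borelInt_eq_zpow` (`E(μ) = (√q)^{e(μ)}` in `ℂ`).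
* §4 **`coeff_satakeTransform_neg_unitary`**, **`domCongr_neg_satakeTransform_unitary`**, `satakeTransform_mem_setOf_unitary`.

## References
* [CartierCorvallis1979] P. Cartier, *Representations of 𝔭-adic groups: a survey*, PSPM 33.1 (1979), §IV (4.2), Thm. 4.1.
* [Laumon1995] G. Laumon, *Cohomology of Drinfeld Modular Varieties I*, CUP (1996), (4.1.4)–(4.1.6).
* [Minguez2011] A. Mínguez, *Unramified representations of unitary groups*, in: *On the stabilization of the trace
  formula* (2011), §4.
* [Rogawski1990] J. D. Rogawski, *Automorphic Representations of Unitary Groups in Three Variables*, Ann. of Math. Stud.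
  123 (1990), §4.5 p. 50.
* [Satake1963] I. Satake, *Theory of spherical functions on reductive algebraic groups over 𝔭-adic fields*, Publ. Math.
  IHÉS 18 (1963), §§6–7.
* [Macdonald1995] I. G. Macdonald, *Symmetric Functions and Hall Polynomials*, 2nd ed. (1995), Ch. V (2.6)–(2.7).
* [GetzHahn2024] J. Getz, H. Hahn, *An Introduction to Automorphic Representations*, GTM 300 (2024), §7.5 (7.16)–(7.17),
  Prop. 3.5.1.
-/

noncomputable section

open scoped Valued WithZero Matrix MatrixGroups Pointwise
open MonoidAlgebra Representation Finset MulAction ConjAct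

namespace Literature.NumberTheory.Automorphic.HermitianLattice

open Literature.NumberTheory.Automorphic.CartanUnique Literature.NumberTheory.Automorphic.SymplecticCartan
  Literature.NumberTheory.Automorphic

variable {K : Type*} [Field K] [Valued K ℤᵐ⁰] {σ : K →+* K} {ϖ : K} {N : ℕ}

/-! ## §1 The double count `∑_{i<j} (a_i - a_j) = ∑_i (N - 1 - 2i) a_i` -/

omit [Valued K ℤᵐ⁰] in
/-- `∑_{i<j} a_i = ∑_i (N - 1 - i) a_i` (there are `N - 1 - i` indices above `i`). [cite: Laumon1995, (4.1.4)] -/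
theorem sum_filter_lt_fst_eq (a : Fin N → ℤ) :
    ∑ p ∈ (Finset.univ : Finset (Fin N × Fin N)) with p.1 < p.2, a p.1 = ∑ i : Fin N, ((N : ℤ) - 1 - (i : ℕ)) * a i := by
  rw [Finset.sum_filter, ← Finset.univ_product_univ, Finset.sum_product]
  refine Finset.sum_congr rfl fun i _ => ?_
  dsimp only
  rw [← Finset.sum_filter, Finset.sum_const, nsmul_eq_mul, Finset.filter_lt_eq_Ioi, Fin.card_Ioi]
  have hi := i.2
  push_cast [Nat.cast_sub (show (i : ℕ) ≤ N - 1 by omega), Nat.cast_sub (show 1 ≤ N by omega)]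
  ring

omit [Valued K ℤᵐ⁰] in
/-- `∑_{i<j} a_j = ∑_j j a_j` (there are `j` indices below `j`). [cite: Laumon1995, (4.1.4)] -/
theorem sum_filter_lt_snd_eq (a : Fin N → ℤ) :
    ∑ p ∈ (Finset.univ : Finset (Fin N × Fin N)) with p.1 < p.2, a p.2 = ∑ j : Fin N, ((j : ℕ) : ℤ) * a j := by
  rw [Finset.sum_filter, ← Finset.univ_product_univ, Finset.sum_product, Finset.sum_comm]
  refine Finset.sum_congr rfl fun j _ => ?_
  dsimp only
  rw [← Finset.sum_filter, Finset.sum_const, nsmul_eq_mul, Finset.filter_gt_eq_Iio, Fin.card_Iio]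

omit [Valued K ℤᵐ⁰] in
/-- **`∑_{i<j} (a_i - a_j) = ∑_i (N - 1 - 2i) a_i`** (`= ⟨2ρ, a⟩` for `GL_N`). [cite: Laumon1995, (4.1.4)]
[cite: CartierCorvallis1979, §IV (4.2)] -/
theorem sum_filter_lt_sub_eq (a : Fin N → ℤ) :
    ∑ p ∈ (Finset.univ : Finset (Fin N × Fin N)) with p.1 < p.2, (a p.1 - a p.2) =
      ∑ i : Fin N, ((N : ℤ) - 1 - 2 * (i : ℕ)) * a i := by
  rw [Finset.sum_sub_distrib, sum_filter_lt_fst_eq, sum_filter_lt_snd_eq, ← Finset.sum_sub_distrib]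
  exact Finset.sum_congr rfl fun i _ => by ring

omit [Valued K ℤᵐ⁰] in
/-- **`∑_{i<j} (a_i - a_j) = 2⟨ν, a⟩`** for antisymmetric `a` (`⟨ν, a⟩ = ∑_i (N-1-i) a_i = satakeTwistExp a`): the
exponent of the modulus of the Borel of `U(σ, J₀)` in base `√q` is twice the exponent of its Satake weights.
[cite: CartierCorvallis1979, §IV (4.2)] [cite: Minguez2011, §4] -/
theorem sum_filter_lt_sub_eq_two_mul_satakeTwistExp (a : Fin N → ℤ) (ha : ∀ i, a (Fin.rev i) = -a i) :
    ∑ p ∈ (Finset.univ : Finset (Fin N × Fin N)) with p.1 < p.2, (a p.1 - a p.2) = 2 * satakeTwistExp a := by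
  rw [sum_filter_lt_sub_eq, two_mul_satakeTwistExp_of_rev a ha]

omit [Valued K ℤᵐ⁰] in
/-- `⟨ν, -a⟩ = -⟨ν, a⟩`. [cite: CartierCorvallis1979, §IV (4.2)] -/
theorem satakeTwistExp_neg (a : Fin N → ℤ) : satakeTwistExp (-a) = -satakeTwistExp a := by
  have h := satakeTwistExp_add a (-a)
  rw [add_neg_cancel, satakeTwistExp_zero] at h
  linarith

namespace UnramifiedLocalConjDatum

/-! ## §2 The dual index `[t_μK_Pt_μ⁻¹ : K_P ∩ t_μK_Pt_μ⁻¹]` and the dominant-extreme coset count, for every `N` -/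

/-- **The dual index for every `N`**: `[t_μK_Pt_μ⁻¹ : K_P ∩ t_μK_Pt_μ⁻¹] = q^{∑_{i<j, i<j'} (μ_j-μ_i)⁺} · (√q)^{∑_{i<j, j=i'} (μ_j-μ_i)⁺}`
for every antisymmetric `μ` (conjugate by `t_μ⁻¹ = t_{-μ}` and apply g47-#2 to `-μ`). [cite: Laumon1995, (4.1.4)]
[cite: CartierCorvallis1979, §I.3, §IV (4.2)] [cite: Minguez2011, §4] -/
theorem relIndex_borelInt_conjAct_eq_unitary (hd : UnramifiedLocalConjDatum σ ϖ) (hσ : ∃ x : K, σ x ≠ x) [Finite 𝓀[K]]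
    {μ : Fin N → ℤ} (hμ : ∀ i, μ (Fin.rev i) = -μ i) :
    (hd.borelLatticeU ⊓ unitaryInt σ ((StdForm.antidiagonal N).over K)).relIndex
        (toConjAct (⟨zpowDiagGL (uniformizer_ne_zero hd.vϖ) μ, zpowDiagGL_mem_unitaryGroupOfForm hd.σϖ _ hμ⟩ :
            unitaryGroupOfForm σ ((StdForm.antidiagonal N).over K)) •
          (hd.borelLatticeU ⊓ unitaryInt σ ((StdForm.antidiagonal N).over K))) =
      Nat.card 𝓀[K] ^ (∑ p ∈ (Finset.univ : Finset (Fin N × Fin N)) with (p.1 < p.2 ∧ p.1 < Fin.rev p.2),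
          (μ p.2 - μ p.1).toNat) *
        Nat.sqrt (Nat.card 𝓀[K]) ^ (∑ p ∈ (Finset.univ : Finset (Fin N × Fin N)) with (p.1 < p.2 ∧ p.2 = Fin.rev p.1),
          (μ p.2 - μ p.1).toNat) := by
  have hneg : ∀ i, (-μ) (Fin.rev i) = -(-μ) i := fun i => by rw [Pi.neg_apply, Pi.neg_apply, hμ]
  have e : (⟨zpowDiagGL (uniformizer_ne_zero hd.vϖ) (-μ), zpowDiagGL_mem_unitaryGroupOfForm hd.σϖ _ hneg⟩ :
        unitaryGroupOfForm σ ((StdForm.antidiagonal N).over K)) =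
      (⟨zpowDiagGL (uniformizer_ne_zero hd.vϖ) μ, zpowDiagGL_mem_unitaryGroupOfForm hd.σϖ _ hμ⟩ :
        unitaryGroupOfForm σ ((StdForm.antidiagonal N).over K))⁻¹ :=
    Subtype.ext (zpowDiagGL_neg _ μ)
  have h := hd.relIndex_conjAct_borelInt_eq_unitary hσ hneg
  rw [e, toConjAct_inv] at h
  have e' := Subgroup.relIndex_pointwise_smul
    (toConjAct (⟨zpowDiagGL (uniformizer_ne_zero hd.vϖ) μ, zpowDiagGL_mem_unitaryGroupOfForm hd.σϖ _ hμ⟩ :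
      unitaryGroupOfForm σ ((StdForm.antidiagonal N).over K)))⁻¹
    (hd.borelLatticeU ⊓ unitaryInt σ ((StdForm.antidiagonal N).over K))
    (toConjAct (⟨zpowDiagGL (uniformizer_ne_zero hd.vϖ) μ, zpowDiagGL_mem_unitaryGroupOfForm hd.σϖ _ hμ⟩ :
      unitaryGroupOfForm σ ((StdForm.antidiagonal N).over K)) • (hd.borelLatticeU ⊓ unitaryInt σ ((StdForm.antidiagonal N).over K)))
  rw [inv_smul_smul] at e'
  rw [← e', h]
  simp only [Pi.neg_apply, sub_neg_eq_add, neg_add_eq_sub]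

/-- **The dual index for ANTIDOMINANT `c`** (`c` monotone and antisymmetric): `[t_cK_Pt_c⁻¹ : K_P] = (√q)^{∑_{i<j} (c_j - c_i)}`
(then `K_P ≤ t_cK_Pt_c⁻¹`; `= q_F^{-⟨2ρ, c⟩}`). [cite: Laumon1995, (4.1.4)–(4.1.6)] [cite: CartierCorvallis1979, §IV (4.2)]
[cite: Minguez2011, §4] -/
theorem relIndex_borelInt_conjAct_eq_pow_sum_unitary (hd : UnramifiedLocalConjDatum σ ϖ) (hσ : ∃ x : K, σ x ≠ x)
    [Finite 𝓀[K]] {c : Fin N → ℤ} (hc : Monotone c) (hc' : ∀ i, c (Fin.rev i) = -c i) :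
    (hd.borelLatticeU ⊓ unitaryInt σ ((StdForm.antidiagonal N).over K)).relIndex
        (toConjAct (⟨zpowDiagGL (uniformizer_ne_zero hd.vϖ) c, zpowDiagGL_mem_unitaryGroupOfForm hd.σϖ _ hc'⟩ :
            unitaryGroupOfForm σ ((StdForm.antidiagonal N).over K)) •
          (hd.borelLatticeU ⊓ unitaryInt σ ((StdForm.antidiagonal N).over K))) =
      Nat.sqrt (Nat.card 𝓀[K]) ^
        (∑ p ∈ (Finset.univ : Finset (Fin N × Fin N)) with p.1 < p.2, (c p.2 - c p.1)).toNat := by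
  have hneg : ∀ i, (-c) (Fin.rev i) = -(-c) i := fun i => by rw [Pi.neg_apply, Pi.neg_apply, hc']
  have e : (⟨zpowDiagGL (uniformizer_ne_zero hd.vϖ) (-c), zpowDiagGL_mem_unitaryGroupOfForm hd.σϖ _ hneg⟩ :
        unitaryGroupOfForm σ ((StdForm.antidiagonal N).over K)) =
      (⟨zpowDiagGL (uniformizer_ne_zero hd.vϖ) c, zpowDiagGL_mem_unitaryGroupOfForm hd.σϖ _ hc'⟩ :
        unitaryGroupOfForm σ ((StdForm.antidiagonal N).over K))⁻¹ :=
    Subtype.ext (zpowDiagGL_neg _ c)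
  have h := hd.relIndex_conjAct_borelInt_eq_pow_sum_unitary hσ (μ := -c) hc.neg hneg
  rw [e, toConjAct_inv] at h
  have e' := Subgroup.relIndex_pointwise_smul
    (toConjAct (⟨zpowDiagGL (uniformizer_ne_zero hd.vϖ) c, zpowDiagGL_mem_unitaryGroupOfForm hd.σϖ _ hc'⟩ :
      unitaryGroupOfForm σ ((StdForm.antidiagonal N).over K)))⁻¹
    (hd.borelLatticeU ⊓ unitaryInt σ ((StdForm.antidiagonal N).over K))
    (toConjAct (⟨zpowDiagGL (uniformizer_ne_zero hd.vϖ) c, zpowDiagGL_mem_unitaryGroupOfForm hd.σϖ _ hc'⟩ :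
      unitaryGroupOfForm σ ((StdForm.antidiagonal N).over K)) • (hd.borelLatticeU ⊓ unitaryInt σ ((StdForm.antidiagonal N).over K)))
  rw [inv_smul_smul] at e'
  rw [← e', h]
  simp only [Pi.neg_apply, sub_neg_eq_add, neg_add_eq_sub]

/-- **THE DOMINANT-EXTREME COSET COUNT FOR EVERY `N`**: for `c` antidominant (monotone, antisymmetric) the number of left
`K₀`-cosets `γ` of `K₀t_cK₀` with Iwasawa exponent `a(γ) = -c` (the dominant extreme, i.e. the big cell) is
`#{γ ∈ K₀t_cK₀/K₀ : a(γ) = -c} = [t_cK_Pt_c⁻¹ : K_P] = (√q)^{∑_{i<j} (c_j - c_i)} = q_F^{⟨2ρ, -c⟩}`.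
[cite: Macdonald1995, Ch. V (2.6)–(2.7)] [cite: Laumon1995, (4.1.6)] [cite: CartierCorvallis1979, §IV (4.2)] -/
theorem card_filter_iwasawaExp_orbit_neg_eq_pow_unitary
    [IsHeckeTriple (⊤ : Submonoid (unitaryGroupOfForm σ ((StdForm.antidiagonal N).over K)))
      (unitaryInt σ ((StdForm.antidiagonal N).over K)) (unitaryInt σ ((StdForm.antidiagonal N).over K))]
    (hd : UnramifiedLocalConjDatum σ ϖ) (hσ : ∃ x : K, σ x ≠ x) [Finite 𝓀[K]] {c : Fin N → ℤ} (hc : Monotone c)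
    (hc' : ∀ i, c (Fin.rev i) = -c i)
    [DecidablePred fun α : unitaryGroupOfForm σ ((StdForm.antidiagonal N).over K) ⧸ unitaryInt σ ((StdForm.antidiagonal N).over K) =>
      hd.iwasawaExp α.out = -c] :
    ((finite_orbit_quotient (unitaryInt σ ((StdForm.antidiagonal N).over K))
        (⟨zpowDiagGL (uniformizer_ne_zero hd.vϖ) c, zpowDiagGL_mem_unitaryGroupOfForm hd.σϖ _ hc'⟩ :
          unitaryGroupOfForm σ ((StdForm.antidiagonal N).over K))).toFinset.filter
          (fun α => hd.iwasawaExp α.out = -c)).card =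
      Nat.sqrt (Nat.card 𝓀[K]) ^
        (∑ p ∈ (Finset.univ : Finset (Fin N × Fin N)) with p.1 < p.2, (c p.2 - c p.1)).toNat := by
  rw [hd.card_filter_iwasawaExp_orbit_neg_eq_relIndex_unitary hc hc', hd.relIndex_borelInt_conjAct_eq_pow_sum_unitary hσ hc hc']

end UnramifiedLocalConjDatum

/-! ## §3 Exponent bookkeeping: `e(μ) - e(-μ) = ∑_{i<j} (μ_i - μ_j) = 2⟨ν, μ⟩` -/

omit [Valued K ℤᵐ⁰] in
/-- `∑ x⁺ - ∑ (-x)⁺ = ∑ x` over a finset (termwise `x⁺ - (-x)⁺ = x`). [cite: Laumon1995, (4.1.4)] -/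
theorem toNat_sum_sub_toNat_sum_neg {ι : Type*} (s : Finset ι) (f : ι → ℤ) :
    ((∑ x ∈ s, (f x).toNat : ℕ) : ℤ) - ((∑ x ∈ s, (-f x).toNat : ℕ) : ℤ) = ∑ x ∈ s, f x := by
  rw [Nat.cast_sum, Nat.cast_sum, ← Finset.sum_sub_distrib]
  exact Finset.sum_congr rfl fun x _ => Int.toNat_sub_toNat_neg (f x)

omit [Valued K ℤᵐ⁰] in
/-- **`e(μ) - e(-μ) = 2⟨ν, μ⟩`** for antisymmetric `μ`, where
`e(μ) = 2∑_{i<j, i<j'} (μ_i-μ_j)⁺ + ∑_{i<j, j=i'} (μ_i-μ_j)⁺` is the exponent of `[K_P : K_P ∩ t_μK_Pt_μ⁻¹]` in base `√q`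
(g47-#2) and `e(-μ)` that of the dual index. [cite: Laumon1995, (4.1.4)–(4.1.6)] [cite: CartierCorvallis1979, §IV (4.2)] -/
theorem modulusExp_sub_modulusExp_neg {μ : Fin N → ℤ} (hμ : ∀ i, μ (Fin.rev i) = -μ i) :
    ((2 * (∑ p ∈ (Finset.univ : Finset (Fin N × Fin N)) with (p.1 < p.2 ∧ p.1 < Fin.rev p.2), (μ p.1 - μ p.2).toNat) +
        ∑ p ∈ (Finset.univ : Finset (Fin N × Fin N)) with (p.1 < p.2 ∧ p.2 = Fin.rev p.1), (μ p.1 - μ p.2).toNat : ℕ) : ℤ) -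
      ((2 * (∑ p ∈ (Finset.univ : Finset (Fin N × Fin N)) with (p.1 < p.2 ∧ p.1 < Fin.rev p.2), (μ p.2 - μ p.1).toNat) +
        ∑ p ∈ (Finset.univ : Finset (Fin N × Fin N)) with (p.1 < p.2 ∧ p.2 = Fin.rev p.1), (μ p.2 - μ p.1).toNat : ℕ) : ℤ) =
      2 * satakeTwistExp μ := by
  have hP := toNat_sum_sub_toNat_sum_neg
    ((Finset.univ : Finset (Fin N × Fin N)).filter fun p => p.1 < p.2 ∧ p.1 < Fin.rev p.2) fun p => μ p.1 - μ p.2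
  have hD := toNat_sum_sub_toNat_sum_neg
    ((Finset.univ : Finset (Fin N × Fin N)).filter fun p => p.1 < p.2 ∧ p.2 = Fin.rev p.1) fun p => μ p.1 - μ p.2
  simp only [neg_sub] at hP hD
  rw [← sum_filter_lt_sub_eq_two_mul_satakeTwistExp μ hμ, ← two_mul_sum_add_sum_eq hμ, ← hP, ← hD]
  push_cast
  ring

namespace UnramifiedLocalConjDatum

/-- **`[K_P : K_P ∩ t_μK_Pt_μ⁻¹] = (√q)^{e(μ)}` in `ℂ`**, `√q = residueCardSqrt K` the base of the Satake weights
(`= Nat.sqrt q` since `q` is a square for `σ ≠ id`). [cite: CartierCorvallis1979, §IV (4.2)] [cite: Laumon1995, (4.1.4)] -/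
theorem natCast_relIndex_conjAct_borelInt_eq_zpow (hd : UnramifiedLocalConjDatum σ ϖ) (hσ : ∃ x : K, σ x ≠ x)
    [Finite 𝓀[K]] {μ : Fin N → ℤ} (hμ : ∀ i, μ (Fin.rev i) = -μ i) :
    (((toConjAct (⟨zpowDiagGL (uniformizer_ne_zero hd.vϖ) μ, zpowDiagGL_mem_unitaryGroupOfForm hd.σϖ _ hμ⟩ :
          unitaryGroupOfForm σ ((StdForm.antidiagonal N).over K)) •
        (hd.borelLatticeU ⊓ unitaryInt σ ((StdForm.antidiagonal N).over K))).relIndex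
        (hd.borelLatticeU ⊓ unitaryInt σ ((StdForm.antidiagonal N).over K)) : ℕ) : ℂ) =
      residueCardSqrt K ^
        (((2 * (∑ p ∈ (Finset.univ : Finset (Fin N × Fin N)) with (p.1 < p.2 ∧ p.1 < Fin.rev p.2), (μ p.1 - μ p.2).toNat) +
          ∑ p ∈ (Finset.univ : Finset (Fin N × Fin N)) with (p.1 < p.2 ∧ p.2 = Fin.rev p.1), (μ p.1 - μ p.2).toNat : ℕ) : ℤ)) := by
  rw [hd.relIndex_conjAct_borelInt_eq_unitary hσ hμ, zpow_natCast, pow_add, pow_mul, Nat.cast_mul, Nat.cast_pow, Nat.cast_pow,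
    ← hd.residueCardSqrt_eq_natCast_sqrt hσ, residueCardSqrt_sq]

/-- The dual: **`[t_μK_Pt_μ⁻¹ : K_P ∩ t_μK_Pt_μ⁻¹] = (√q)^{e(-μ)}` in `ℂ`**. [cite: CartierCorvallis1979, §IV (4.2)]
[cite: Laumon1995, (4.1.4)] -/
theorem natCast_relIndex_borelInt_conjAct_eq_zpow (hd : UnramifiedLocalConjDatum σ ϖ) (hσ : ∃ x : K, σ x ≠ x)
    [Finite 𝓀[K]] {μ : Fin N → ℤ} (hμ : ∀ i, μ (Fin.rev i) = -μ i) :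
    (((hd.borelLatticeU ⊓ unitaryInt σ ((StdForm.antidiagonal N).over K)).relIndex
        (toConjAct (⟨zpowDiagGL (uniformizer_ne_zero hd.vϖ) μ, zpowDiagGL_mem_unitaryGroupOfForm hd.σϖ _ hμ⟩ :
            unitaryGroupOfForm σ ((StdForm.antidiagonal N).over K)) •
          (hd.borelLatticeU ⊓ unitaryInt σ ((StdForm.antidiagonal N).over K))) : ℕ) : ℂ) =
      residueCardSqrt K ^
        (((2 * (∑ p ∈ (Finset.univ : Finset (Fin N × Fin N)) with (p.1 < p.2 ∧ p.1 < Fin.rev p.2), (μ p.2 - μ p.1).toNat) +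
          ∑ p ∈ (Finset.univ : Finset (Fin N × Fin N)) with (p.1 < p.2 ∧ p.2 = Fin.rev p.1), (μ p.2 - μ p.1).toNat : ℕ) : ℤ)) := by
  rw [hd.relIndex_borelInt_conjAct_eq_unitary hσ hμ, zpow_natCast, pow_add, pow_mul, Nat.cast_mul, Nat.cast_pow, Nat.cast_pow,
    ← hd.residueCardSqrt_eq_natCast_sqrt hσ, residueCardSqrt_sq]

/-! ## §4 `𝒮(T)_{-μ} = 𝒮(T)_μ` for every `N` -/

variable [Finite 𝓀[K]]
  [IsHeckeTriple (⊤ : Submonoid (unitaryGroupOfForm σ ((StdForm.antidiagonal N).over K)))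
    (unitaryInt σ ((StdForm.antidiagonal N).over K)) (unitaryInt σ ((StdForm.antidiagonal N).over K))]

/-- **`𝒮(T)_{-μ} = 𝒮(T)_μ` FOR EVERY `N`, EVERY `T ∈ ℋ(U(σ, J₀), K₀; ℂ)` AND EVERY `μ`** — the unitarily normalised Satake
transform of the unramified unitary group in `N` variables (weights `(√q)^{-⟨ν,·⟩} = δ_B^{1/2}`, `q = #𝓀[K]`, `σ ≠ id`)
takes values in the invariants of `w₀ = -1 ∈ W`: g44-#3's weighted duality with both indices evaluated (g47-#2 and §2),
the two sides carrying the same power `(√q)^{⟨ν,μ⟩ + e(-μ)} = (√q)^{-⟨ν,μ⟩ + e(μ)}` (§3); off `Λ⁻` both coefficients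
vanish.  This is Cartier's Theorem 4.1 for the element `w₀`; for `N = 2, 3` (`W = {1, w₀}`) it is the full
`W`-invariance of `UnitaryRankOneSatakeClassical`. [cite: CartierCorvallis1979, §IV (4.2), Thm. 4.1]
[cite: Laumon1995, (4.1.4)–(4.1.6)] [cite: Minguez2011, §4] [cite: Rogawski1990, §4.5 p. 50] [cite: Satake1963, §§6–7] -/
theorem coeff_satakeTransform_neg_unitary (hd : UnramifiedLocalConjDatum σ ϖ) (hσ : ∃ x : K, σ x ≠ x)
    (T : heckeAlgebra ℂ (unitaryGroupOfForm σ ((StdForm.antidiagonal N).over K)) (unitaryInt σ ((StdForm.antidiagonal N).over K)))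
    (μ : Fin N → ℤ) : (hd.satakeTransform T).coeff (-μ) = (hd.satakeTransform T).coeff μ := by
  rw [hd.satakeTransform_eq_isIwasawaExponent_satakeTransform]
  by_cases hμ : ∀ i, μ (Fin.rev i) = -μ i
  · have hs : residueCardSqrt K ≠ 0 := residueCardSqrt_ne_zero
    have hneg : ∀ i, (-μ) (Fin.rev i) = -(-μ) i := fun i => by rw [Pi.neg_apply, Pi.neg_apply, hμ]
    have key := hd.coeff_satakeTransform_mul_relIndex_eq_unitary (R := ℂ)
      (satakeWeightHom (residueCardSqrt K) residueCardSqrt_ne_zero) T hμ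
    rw [hd.natCast_relIndex_borelInt_conjAct_eq_zpow hσ hμ, hd.natCast_relIndex_conjAct_borelInt_eq_zpow hσ hμ,
      satakeWeightHom_ofAdd, satakeWeightHom_ofAdd, satakeWeight, satakeWeight, mul_assoc, mul_assoc, ← zpow_add₀ hs,
      ← zpow_add₀ hs, satakeTwistExp_neg, show -(-satakeTwistExp μ) +
        (((2 * (∑ p ∈ (Finset.univ : Finset (Fin N × Fin N)) with (p.1 < p.2 ∧ p.1 < Fin.rev p.2), (μ p.2 - μ p.1).toNat) +
          ∑ p ∈ (Finset.univ : Finset (Fin N × Fin N)) with (p.1 < p.2 ∧ p.2 = Fin.rev p.1), (μ p.2 - μ p.1).toNat : ℕ) : ℤ)) =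
        -satakeTwistExp μ +
        (((2 * (∑ p ∈ (Finset.univ : Finset (Fin N × Fin N)) with (p.1 < p.2 ∧ p.1 < Fin.rev p.2), (μ p.1 - μ p.2).toNat) +
          ∑ p ∈ (Finset.univ : Finset (Fin N × Fin N)) with (p.1 < p.2 ∧ p.2 = Fin.rev p.1), (μ p.1 - μ p.2).toNat : ℕ) : ℤ))
        by have := modulusExp_sub_modulusExp_neg hμ; omega] at key
    exact (mul_right_cancel₀ (zpow_ne_zero _ hs) key).symm
  · have hμ' : ¬ ∀ i, (-μ) (Fin.rev i) = -(-μ) i := fun h => hμ fun i => by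
      have := h i; rw [Pi.neg_apply, Pi.neg_apply] at this; omega
    rw [hd.coeff_satakeTransform_eq_zero_of_not_rev _ T hμ, hd.coeff_satakeTransform_eq_zero_of_not_rev _ T hμ']

/-- **`ι(𝒮 T) = 𝒮 T`** for `ι(x^μ) = x^{-μ}` and every `T ∈ ℋ(U(σ, J₀), K₀; ℂ)`, every `N`: the Satake image is
`w₀`-invariant. [cite: CartierCorvallis1979, §IV Thm. 4.1] [cite: Minguez2011, §4] -/
theorem domCongr_neg_satakeTransform_unitary (hd : UnramifiedLocalConjDatum σ ϖ) (hσ : ∃ x : K, σ x ≠ x)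
    (T : heckeAlgebra ℂ (unitaryGroupOfForm σ ((StdForm.antidiagonal N).over K)) (unitaryInt σ ((StdForm.antidiagonal N).over K))) :
    AddMonoidAlgebra.domCongr ℂ ℂ (AddEquiv.neg (Fin N → ℤ)) (hd.satakeTransform T) = hd.satakeTransform T := by
  refine AddMonoidAlgebra.ext (Finsupp.ext fun μ => ?_)
  rw [IsIwasawaExponent.coeff_domCongr_neg, hd.coeff_satakeTransform_neg_unitary hσ]

/-- **`range 𝒮 ⊆ ℂ[Λ⁻]^{w₀}`** for every `N`: every Satake transform vanishes off the antisymmetric cocharacters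
`Λ⁻ = {μ : μ ∘ rev = -μ}` and is even under `μ ↦ -μ`. (For `N = 2, 3` equality holds, `UnitaryRankOneSatakeClassical`;
for `N ≥ 4` the `S_n`-part of the Weyl group is not addressed here.) [cite: CartierCorvallis1979, §IV Thm. 4.1]
[cite: Rogawski1990, §4.5 p. 50] [cite: Minguez2011, §4] -/
theorem satakeTransform_mem_setOf_unitary (hd : UnramifiedLocalConjDatum σ ϖ) (hσ : ∃ x : K, σ x ≠ x)
    (T : heckeAlgebra ℂ (unitaryGroupOfForm σ ((StdForm.antidiagonal N).over K)) (unitaryInt σ ((StdForm.antidiagonal N).over K))) :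
    hd.satakeTransform T ∈
      {g : AddMonoidAlgebra ℂ (Fin N → ℤ) | (∀ μ : Fin N → ℤ, (¬ ∀ i, μ (Fin.rev i) = -μ i) → g.coeff μ = 0) ∧
        ∀ μ : Fin N → ℤ, g.coeff (-μ) = g.coeff μ} := by
  refine ⟨fun μ hμ => ?_, fun μ => hd.coeff_satakeTransform_neg_unitary hσ T μ⟩
  rw [hd.satakeTransform_eq_isIwasawaExponent_satakeTransform]
  exact hd.coeff_satakeTransform_eq_zero_of_not_rev _ T hμ

end UnramifiedLocalConjDatum

end Literature.NumberTheory.Automorphic.HermitianLattice
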